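import Summits.BirchSwinnertonDyer.BirchSwinnertonDyer.Theorems.GenusKolyvaginAtTwoShaCardDvdPowAtTwoRTShaFiniteAtTwo
import Summits.BirchSwinnertonDyer.BirchSwinnertonDyer.Theorems.GenusKolyvaginAtTwoCasselsTateTotallyComplex
import Literature.GroupTheory.FiniteAbelian.SymplecticModules
import Literature.NumberTheory.EllipticCurves.CasselsTateLevelPrimary
import HarnessLib

/-!
# Route `GenusKolyvaginAtTwo`, crux U_T `ShaCardDvdPowAtTwoRT` (stmt-BirchSwinnertonDyer-23658) —
# THE CASSELS–TATE FRAME ON ALL OF `Ш(E/K)[2^∞]` ON U_T's FRAME, and U_T AS A BOUND ON ISOTROPIC SUBGROUPS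

Seat `bsd-line-gk2-p5` g29 (WIDTH-5 attach, cell `bsd-f1-sign2`), `--supports stmt-BirchSwinnertonDyer-23658` (helper; closes nothing).
THEOREMS ONLY (no definition, no named fact, no `sorry`).  BSD is NOT proved by any of this; neither is U_T.

WHY.  McCallum's count (1991 §5, proof of Thm. 5.4, p. 288) starts from: `Ш(E/K)_{p^∞}` is finite and killed by `p^{M₀'}`, so the
Cassels–Tate pairing restricts to a NON-DEGENERATE alternating pairing on ALL of `Ш(E/K)_{p^∞}`; fix a maximal isotropic subgroup
`D`; then `#Ш(E/K)_{p^∞} = #D²` and the theorem is the bound `#D ≤ p^{M₀}`, obtained from Kolyvagin-class characters on `D`.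
`…RTShaFiniteAtTwo` (this seat, p746739) supplies the first clause AT `2` on U_T's frame (`Ш(E/K)[2^∞] = Ш(E/K)[2^(M₀+2)]`, finite,
`#Ш(E/K)[2^∞] = 2^(2t)`).  This file supplies the rest of the FRAME, so that a U_T line only has to bound isotropic subgroups:

* §1 `exists_primaryComponent_pairing_of_isLevelPairing_onHabitat` — on U_T's frame EVERY level pairing `B` on `Ш(E/K)[2^k]`, `k ≥ M₀ + 2`
  (e.g. gk2-p4's `exists_isLevelPairing_forall_opposite_signs_eq_zero`, which carries the opposite-sign orthogonality, or the canonical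
  `CasselsTateTotallyComplex.isLevelPairing_ctLevelPairing_canonical`) IS a bi-additive pairing `B₂` on `Ш(E/K)[2^∞]` with the same values,
  alternating, antisymmetric, NON-DEGENERATE on both sides (`exists_primaryComponent_pairing_of_isLevelPairing` with `hk` := p746739).
* §2 `exists_nondegenerate_alternating_pairing_primaryComponent_sha_two_onHabitat` — existence form with the canonical Cassels–Tate level
  pairing at level `2^(M₀+2)` (`CasselsTateTotallyComplex.exists_isLevelPairing`, `K` imaginary quadratic hence totally complex).
* §3 `natCard_primaryComponent_sha_two_dvd_iff_le_onHabitat` — since `#Ш(E/K)[2^∞] = 2^(2t)`: **U_T's conclusion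
  `#Ш(E/K)[2^∞] ∣ 2^(2M₀)` ⟺ `#Ш(E/K)[2^∞] ≤ 2^(2M₀)`**.
* §4 `natCard_primaryComponent_sha_two_dvd_of_lagrangian_card_le_onHabitat` / `…_of_forall_isotropic_card_le_onHabitat` — for ANY
  non-degenerate alternating `ℚ/ℤ`-valued pairing on `Ш(E/K)[2^∞]` (e.g. §1/§2): **if one Lagrangian (resp. every isotropic subgroup) has
  order `≤ 2^M₀`, then `#Ш(E/K)[2^∞] ∣ 2^(2M₀)`** — U_T's conclusion (Wall / Tignol–Amitsur `#L² = #T`,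
  `Literature.GroupTheory.FiniteAbelian.exists_lagrangian_sq_eq_card`).  This is McCallum's «fix a maximal isotropic subgroup `D`» door
  at `p = 2`, on the route's frame, with nothing left implicit.

References: [McCallumLMS1991] §5, proof of Thm. 5.4 (p. 288); [MilneADT2006] Ch. I §6, Prop. 6.9, Thm. 6.13 (a); [Cassels1962ArithmeticIV];
[Wall1963QuadraticFormsFiniteGroups] Lemma 7; [TignolAmitsur1986SymplecticModules] Thm. 4.1; [Kolyvagin1990] Thm. A.
-/

set_option autoImplicit false
-- the Theorems namespace of this sub repeats the summit name by design (D-0017 nested layout)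
set_option linter.dupNamespace false

noncomputable section

open scoped Classical
open scoped AddSubgroup

namespace Summit.BirchSwinnertonDyer.BirchSwinnertonDyer.Theorems.GenusExact.PlusDescent

open WeierstrassCurve NumberField IsDedekindDomain Field Literature.NumberTheory.EllipticCurves
  Literature.NumberTheory.GaloisRepresentations Literature.NumberTheory.EllipticCurves.ModularForms AddSubgroup
open Summit.BirchSwinnertonDyer.BirchSwinnertonDyer.Theses.GenusKolyvaginAtTwo (KolyvaginRelationAtTwo)
open Summit.BirchSwinnertonDyer.Rank1Residual
open Literature.GroupTheory.FiniteAbelian (IsLevelPairing)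

/-! ## §1 Every level pairing at level `2^k`, `k ≥ M₀ + 2`, is a non-degenerate pairing on all of `Ш(E/K)[2^∞]` -/

/-- **The Cassels–Tate frame on ALL of `Ш(E/K)[2^∞]`, on U_T's frame.**  For every `k ≥ M₀ + 2` and every LEVEL pairing `B` on `Ш(E/K)[2^k]`
(alternating, kernel `Ш[2^k] ∩ 2^k Ш` — Milne I 6.13 (a) at level `2^k`; e.g. `CasselsTateTotallyComplex.isLevelPairing_ctLevelPairing_canonical` or
gk2-p4's `exists_isLevelPairing_forall_opposite_signs_eq_zero`) there is a bi-additive `B₂ : Ш(E/K)[2^∞] × Ш(E/K)[2^∞] → T` with the SAME values,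
alternating, antisymmetric and NON-DEGENERATE on both sides — because `2^k` kills `Ш(E/K)[2^∞]` on this frame (`…RTShaFiniteAtTwo`).
[cite: McCallumLMS1991, §5, proof of Thm. 5.4 (p. 288)] [cite: MilneADT2006, Ch. I §6, Thm. 6.13 (a)] -/
theorem exists_primaryComponent_pairing_of_isLevelPairing_onHabitat (hQ2 : KolyvaginRelationAtTwo)
    (W : WeierstrassCurve ℚ) [W.IsElliptic] [W.IsGloballyMinimal] [NeZero (W.conductorNorm ℤ)] (hcm : ¬ W.HasCM)
    (hT : Odd W.tamagawaProduct) (v : HeightOneSpectrum (𝓞 ℚ)) (h2v : ((2 : ℕ) : 𝓞 ℚ) ∉ v.asIdeal)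
    (hNv : ((W.conductorNorm ℤ : ℕ) : 𝓞 ℚ) ∈ v.asIdeal) (hmult : W.HasMultiplicativeReductionAt v) (hneg : W.Δ < 0)
    (K : Type) [Field K] [NumberField K] (hIQ : IsImaginaryQuadratic K) (hodd : Odd (NumberField.discr K))
    (h3 : NumberField.discr K ≠ -3) (hHe : SatisfiesHeegnerHypothesis (W.conductorNorm ℤ) K)
    (hsq1 : ¬ IsSquare ((NumberField.discr K : ℚ) * -|W.Δ|)) (hsq2 : ¬ IsSquare ((NumberField.discr K : ℚ) * (-(2 * |W.Δ|))))
    (hρ : ∀ n : ℕ, 0 < n → W.HasSurjectiveModNGaloisRep ((2 : ℤ) ^ n))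
    (Dt : ModularParametrizationData W (W.conductorNorm ℤ)) (β : ℤ) (ι : K →+* ℂ) (d₁ : KolyvaginHeegnerData Dt β ι 1) (M₀ : ℕ)
    (hndiv : ¬ ∃ Q : (W.baseChange (ringClassField K ι 1)).toAffine.Point, ((2 ^ (M₀ + 1) : ℕ) : ℤ) • Q = d₁.derivedPoint)
    {k : ℕ} (hk : M₀ + 2 ≤ k) {T : Type*} [AddCommGroup T]
    (B : ((W.baseChange K).sha)[(2 ^ k : ℕ)] →+ ((W.baseChange K).sha)[(2 ^ k : ℕ)] →+ T) (hB : IsLevelPairing (2 ^ k) B) :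
    ∃ (hle : AddCommGroup.primaryComponent (W.baseChange K).sha 2 ≤ ((W.baseChange K).sha)[(2 ^ k : ℕ)])
      (B₂ : AddCommGroup.primaryComponent (W.baseChange K).sha 2 →+ AddCommGroup.primaryComponent (W.baseChange K).sha 2 →+ T),
      (∀ a b, B₂ a b = B ⟨a, hle a.2⟩ ⟨b, hle b.2⟩) ∧
      (∀ a, B₂ a a = 0) ∧ (∀ a b, B₂ b a = -(B₂ a b)) ∧
      (∀ a, (∀ b, B₂ a b = 0) → a = 0) ∧ (∀ b, (∀ a, B₂ a b = 0) → b = 0) := by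
  haveI hell : (W.baseChange K).IsElliptic := inferInstanceAs ((W.map (algebraMap ℚ K)).IsElliptic)
  -- `2^(M₀+2)` kills `Ш(E/K)[2^∞]`, hence so does `2^k`
  have hk0 := two_pow_smul_primaryComponent_sha_eq_zero_onHabitat hQ2 W hcm hT v h2v hNv hmult hneg K hIQ hodd h3 hHe hsq1 hsq2 hρ Dt β ι
    d₁ M₀ hndiv
  have hkk : ∀ x ∈ AddCommGroup.primaryComponent (W.baseChange K).sha 2, 2 ^ k • x = 0 :=
    pow_nsmul_primaryComponent_eq_zero_of_le hk0 hk
  obtain ⟨B₂, hval, halt, hanti, hl, hr⟩ := exists_primaryComponent_pairing_of_isLevelPairing (W.baseChange K) Nat.prime_two B hB hkk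
  exact ⟨primaryComponent_le_torsionBy hkk, B₂, hval, halt, hanti, hl, hr⟩

/-! ## §2 Existence: the canonical Cassels–Tate pairing at level `2^(M₀+2)` on all of `Ш(E/K)[2^∞]` -/

/-- **`Ш(E/K)[2^∞]` carries a NON-DEGENERATE alternating `ℚ/ℤ`-valued pairing on U_T's frame, which IS a level-`2^(M₀+2)` Cassels–Tate
pairing** (Milne's `ctLevelPairing` of the canonical invariant maps and a Weil pairing, a LEVEL pairing over the totally complex field `K` by
`CasselsTateTotallyComplex.exists_isLevelPairing`), transported along `Ш(E/K)[2^∞] = Ш(E/K)[2^(M₀+2)]` (§1).  McCallum's opening move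
«the Cassels–Tate pairing is a non-degenerate alternating pairing on `Ш(E/K)_{p^∞}`» at `p = 2`, from Q2 and the tree.
[cite: McCallumLMS1991, §5, proof of Thm. 5.4 (p. 288)] [cite: MilneADT2006, Ch. I §6, Prop. 6.9, Thm. 6.13 (a)] [cite: Cassels1962ArithmeticIV] -/
theorem exists_nondegenerate_alternating_pairing_primaryComponent_sha_two_onHabitat (hQ2 : KolyvaginRelationAtTwo)
    (W : WeierstrassCurve ℚ) [W.IsElliptic] [W.IsGloballyMinimal] [NeZero (W.conductorNorm ℤ)] (hcm : ¬ W.HasCM)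
    (hT : Odd W.tamagawaProduct) (v : HeightOneSpectrum (𝓞 ℚ)) (h2v : ((2 : ℕ) : 𝓞 ℚ) ∉ v.asIdeal)
    (hNv : ((W.conductorNorm ℤ : ℕ) : 𝓞 ℚ) ∈ v.asIdeal) (hmult : W.HasMultiplicativeReductionAt v) (hneg : W.Δ < 0)
    (K : Type) [Field K] [NumberField K] (hIQ : IsImaginaryQuadratic K) (hodd : Odd (NumberField.discr K))
    (h3 : NumberField.discr K ≠ -3) (hHe : SatisfiesHeegnerHypothesis (W.conductorNorm ℤ) K)
    (hsq1 : ¬ IsSquare ((NumberField.discr K : ℚ) * -|W.Δ|)) (hsq2 : ¬ IsSquare ((NumberField.discr K : ℚ) * (-(2 * |W.Δ|))))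
    (hρ : ∀ n : ℕ, 0 < n → W.HasSurjectiveModNGaloisRep ((2 : ℤ) ^ n))
    (Dt : ModularParametrizationData W (W.conductorNorm ℤ)) (β : ℤ) (ι : K →+* ℂ) (d₁ : KolyvaginHeegnerData Dt β ι 1) (M₀ : ℕ)
    (hndiv : ¬ ∃ Q : (W.baseChange (ringClassField K ι 1)).toAffine.Point, ((2 ^ (M₀ + 1) : ℕ) : ℤ) • Q = d₁.derivedPoint) :
    ∃ (B : ((W.baseChange K).sha)[(2 ^ (M₀ + 2) : ℕ)] →+ ((W.baseChange K).sha)[(2 ^ (M₀ + 2) : ℕ)] →+ AddCircle (1 : ℚ))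
      (_ : IsLevelPairing (2 ^ (M₀ + 2)) B)
      (hle : AddCommGroup.primaryComponent (W.baseChange K).sha 2 ≤ ((W.baseChange K).sha)[(2 ^ (M₀ + 2) : ℕ)])
      (B₂ : AddCommGroup.primaryComponent (W.baseChange K).sha 2 →+ AddCommGroup.primaryComponent (W.baseChange K).sha 2 →+
        AddCircle (1 : ℚ)),
      (∀ a b, B₂ a b = B ⟨a, hle a.2⟩ ⟨b, hle b.2⟩) ∧
      (∀ a, B₂ a a = 0) ∧ (∀ a b, B₂ b a = -(B₂ a b)) ∧
      (∀ a, (∀ b, B₂ a b = 0) → a = 0) ∧ (∀ b, (∀ a, B₂ a b = 0) → b = 0) := by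
  haveI hell : (W.baseChange K).IsElliptic := inferInstanceAs ((W.map (algebraMap ℚ K)).IsElliptic)
  haveI : IsTotallyComplex K := hIQ.2
  obtain ⟨B, hB⟩ := CasselsTateTotallyComplex.exists_isLevelPairing (W.baseChange K) 2 (M₀ + 2) Nat.prime_two (by omega)
  obtain ⟨hle, B₂, hval, halt, hanti, hl, hr⟩ := exists_primaryComponent_pairing_of_isLevelPairing_onHabitat hQ2 W hcm hT v h2v hNv hmult
    hneg K hIQ hodd h3 hHe hsq1 hsq2 hρ Dt β ι d₁ M₀ hndiv le_rfl B hB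
  exact ⟨B, hB, hle, B₂, hval, halt, hanti, hl, hr⟩

/-! ## §3 U_T ⟺ `#Ш(E/K)[2^∞] ≤ 4^M₀` -/

/-- **On U_T's frame, `#Ш(E/K)[2^∞] ∣ 2^(2M₀) ⟺ #Ш(E/K)[2^∞] ≤ 2^(2M₀)`** (`#Ш(E/K)[2^∞] = 2^(2t)`, `…RTShaFiniteAtTwo` §4).
[cite: Kolyvagin1990, Thm. A] [cite: McCallumLMS1991, §1 Theorem] -/
theorem natCard_primaryComponent_sha_two_dvd_iff_le_onHabitat (hQ2 : KolyvaginRelationAtTwo)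
    (W : WeierstrassCurve ℚ) [W.IsElliptic] [W.IsGloballyMinimal] [NeZero (W.conductorNorm ℤ)] (hcm : ¬ W.HasCM)
    (hT : Odd W.tamagawaProduct) (v : HeightOneSpectrum (𝓞 ℚ)) (h2v : ((2 : ℕ) : 𝓞 ℚ) ∉ v.asIdeal)
    (hNv : ((W.conductorNorm ℤ : ℕ) : 𝓞 ℚ) ∈ v.asIdeal) (hmult : W.HasMultiplicativeReductionAt v) (hneg : W.Δ < 0)
    (K : Type) [Field K] [NumberField K] (hIQ : IsImaginaryQuadratic K) (hodd : Odd (NumberField.discr K))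
    (h3 : NumberField.discr K ≠ -3) (hHe : SatisfiesHeegnerHypothesis (W.conductorNorm ℤ) K)
    (hsq1 : ¬ IsSquare ((NumberField.discr K : ℚ) * -|W.Δ|)) (hsq2 : ¬ IsSquare ((NumberField.discr K : ℚ) * (-(2 * |W.Δ|))))
    (hρ : ∀ n : ℕ, 0 < n → W.HasSurjectiveModNGaloisRep ((2 : ℤ) ^ n))
    (Dt : ModularParametrizationData W (W.conductorNorm ℤ)) (β : ℤ) (ι : K →+* ℂ) (d₁ : KolyvaginHeegnerData Dt β ι 1) (M₀ : ℕ)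
    (hndiv : ¬ ∃ Q : (W.baseChange (ringClassField K ι 1)).toAffine.Point, ((2 ^ (M₀ + 1) : ℕ) : ℤ) • Q = d₁.derivedPoint) :
    Nat.card (AddCommGroup.primaryComponent (W.baseChange K).sha 2) ∣ 2 ^ (2 * M₀) ↔
      Nat.card (AddCommGroup.primaryComponent (W.baseChange K).sha 2) ≤ 2 ^ (2 * M₀) := by
  obtain ⟨t, ht⟩ := exists_natCard_primaryComponent_sha_two_eq_pow_two_mul_onHabitat hQ2 W hcm hT v h2v hNv hmult hneg K hIQ hodd h3
    hHe hsq1 hsq2 hρ Dt β ι d₁ M₀ hndiv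
  rw [ht, Nat.pow_dvd_pow_iff_le_right (by norm_num), Nat.pow_le_pow_iff_right (by norm_num)]

/-! ## §4 U_T as a bound on isotropic subgroups (McCallum's door at `p = 2`) -/

section Symplectic

variable {X : Type*} [AddCommGroup X]

/-- **Lagrangian door (pure group theory).**  `X` of order `2^(2t)` (e.g. a finite group with an alternating non-degenerate `ℚ/ℤ`-valued
pairing): if SOME subgroup `L` with `#L² = #X` — a Lagrangian — has `#L ≤ 2^M₀`, then `#X ∣ 2^(2M₀)`.
[cite: Wall1963QuadraticFormsFiniteGroups, Lemma 7] [cite: TignolAmitsur1986SymplecticModules, Thm. 4.1] -/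
theorem natCard_dvd_two_pow_two_mul_of_sq_eq_card_of_le {t M₀ : ℕ} (hX : Nat.card X = 2 ^ (2 * t)) (L : AddSubgroup X)
    (hL : Nat.card L ^ 2 = Nat.card X) (hLM : Nat.card L ≤ 2 ^ M₀) : Nat.card X ∣ 2 ^ (2 * M₀) := by
  have hL2 : Nat.card L ^ 2 = (2 ^ t) ^ 2 := by rw [hL, hX, pow_mul, ← pow_mul, mul_comm, pow_mul]
  have hLt : Nat.card L = 2 ^ t := (Nat.pow_left_injective two_ne_zero) hL2
  have htM : t ≤ M₀ := (Nat.pow_le_pow_iff_right (by norm_num : 1 < 2)).mp (hLt ▸ hLM)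
  rw [hX]
  exact Nat.pow_dvd_pow 2 (by omega)

variable [Finite X] (B₂ : X →+ X →+ AddCircle (1 : ℚ))

/-- **Isotropic door (pure group theory).**  `X` finite of order `2^(2t)`, `B₂` alternating non-degenerate into `ℚ/ℤ`: if EVERY isotropic subgroup
`D` (`B₂(D, D) = 0`) has `#D ≤ 2^M₀`, then `#X ∣ 2^(2M₀)` — apply the bound to a Lagrangian (`exists_lagrangian_sq_eq_card`: `#L² = #X`).
[cite: Wall1963QuadraticFormsFiniteGroups, Lemma 7] [cite: McCallumLMS1991, §5, proof of Thm. 5.4 (p. 288)] -/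
theorem natCard_dvd_two_pow_two_mul_of_forall_isotropic_le {t M₀ : ℕ} (hX : Nat.card X = 2 ^ (2 * t))
    (halt : ∀ x, B₂ x x = 0) (hnd : ∀ x, (∀ y, B₂ x y = 0) → x = 0)
    (hiso : ∀ D : AddSubgroup X, (∀ a ∈ D, ∀ b ∈ D, B₂ a b = 0) → Nat.card D ≤ 2 ^ M₀) : Nat.card X ∣ 2 ^ (2 * M₀) := by
  obtain ⟨L, hL, -, hcard⟩ := Literature.GroupTheory.FiniteAbelian.exists_lagrangian_sq_eq_card B₂ halt hnd
  exact natCard_dvd_two_pow_two_mul_of_sq_eq_card_of_le hX L hcard (hiso L hL)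

end Symplectic

/-- **U_T's conclusion from a Lagrangian bound.**  On U_T's frame, for ANY alternating non-degenerate `ℚ/ℤ`-valued pairing on `Ш(E/K)[2^∞]`
(§1/§2): a subgroup `L ≤ Ш(E/K)[2^∞]` with `#L² = #Ш(E/K)[2^∞]` (a Lagrangian, `exists_lagrangian_sq_eq_card`) and `#L ≤ 2^M₀` gives
`#Ш(E/K)[2^∞] ∣ 2^(2M₀)`. [cite: McCallumLMS1991, §5, proof of Thm. 5.4 (p. 288)] [cite: Wall1963QuadraticFormsFiniteGroups, Lemma 7] -/
theorem natCard_primaryComponent_sha_two_dvd_of_lagrangian_card_le_onHabitat (hQ2 : KolyvaginRelationAtTwo)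
    (W : WeierstrassCurve ℚ) [W.IsElliptic] [W.IsGloballyMinimal] [NeZero (W.conductorNorm ℤ)] (hcm : ¬ W.HasCM)
    (hT : Odd W.tamagawaProduct) (v : HeightOneSpectrum (𝓞 ℚ)) (h2v : ((2 : ℕ) : 𝓞 ℚ) ∉ v.asIdeal)
    (hNv : ((W.conductorNorm ℤ : ℕ) : 𝓞 ℚ) ∈ v.asIdeal) (hmult : W.HasMultiplicativeReductionAt v) (hneg : W.Δ < 0)
    (K : Type) [Field K] [NumberField K] (hIQ : IsImaginaryQuadratic K) (hodd : Odd (NumberField.discr K))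
    (h3 : NumberField.discr K ≠ -3) (hHe : SatisfiesHeegnerHypothesis (W.conductorNorm ℤ) K)
    (hsq1 : ¬ IsSquare ((NumberField.discr K : ℚ) * -|W.Δ|)) (hsq2 : ¬ IsSquare ((NumberField.discr K : ℚ) * (-(2 * |W.Δ|))))
    (hρ : ∀ n : ℕ, 0 < n → W.HasSurjectiveModNGaloisRep ((2 : ℤ) ^ n))
    (Dt : ModularParametrizationData W (W.conductorNorm ℤ)) (β : ℤ) (ι : K →+* ℂ) (d₁ : KolyvaginHeegnerData Dt β ι 1) (M₀ : ℕ)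
    (hndiv : ¬ ∃ Q : (W.baseChange (ringClassField K ι 1)).toAffine.Point, ((2 ^ (M₀ + 1) : ℕ) : ℤ) • Q = d₁.derivedPoint)
    (L : AddSubgroup (AddCommGroup.primaryComponent (W.baseChange K).sha 2))
    (hL : Nat.card L ^ 2 = Nat.card (AddCommGroup.primaryComponent (W.baseChange K).sha 2)) (hLM : Nat.card L ≤ 2 ^ M₀) :
    Nat.card (AddCommGroup.primaryComponent (W.baseChange K).sha 2) ∣ 2 ^ (2 * M₀) := by
  obtain ⟨t, ht⟩ := exists_natCard_primaryComponent_sha_two_eq_pow_two_mul_onHabitat hQ2 W hcm hT v h2v hNv hmult hneg K hIQ hodd h3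
    hHe hsq1 hsq2 hρ Dt β ι d₁ M₀ hndiv
  exact natCard_dvd_two_pow_two_mul_of_sq_eq_card_of_le ht L hL hLM

/-- **U_T's conclusion from a bound on isotropic subgroups** — McCallum's door at `p = 2` on U_T's frame: for ANY alternating non-degenerate
`ℚ/ℤ`-valued pairing `B₂` on `Ш(E/K)[2^∞]` (§1: every level-`2^k` Cassels–Tate pairing with `k ≥ M₀+2` is one), if every `B₂`-isotropic
subgroup of `Ш(E/K)[2^∞]` has order `≤ 2^M₀`, then `#Ш(E/K)[2^∞] ∣ 2^(2M₀)`.  So U_T = «bound the isotropic subgroups of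
`(Ш(E/K)[2^∞], CT)` by `2^M₀`» — exactly the content of McCallum's Thm. 5.4 via Kolyvagin-class characters, now the ONLY thing left implicit.
[cite: McCallumLMS1991, §5, Thm. 5.4 and its proof (p. 288)] [cite: Wall1963QuadraticFormsFiniteGroups, Lemma 7] -/
theorem natCard_primaryComponent_sha_two_dvd_of_forall_isotropic_card_le_onHabitat (hQ2 : KolyvaginRelationAtTwo)
    (W : WeierstrassCurve ℚ) [W.IsElliptic] [W.IsGloballyMinimal] [NeZero (W.conductorNorm ℤ)] (hcm : ¬ W.HasCM)
    (hT : Odd W.tamagawaProduct) (v : HeightOneSpectrum (𝓞 ℚ)) (h2v : ((2 : ℕ) : 𝓞 ℚ) ∉ v.asIdeal)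
    (hNv : ((W.conductorNorm ℤ : ℕ) : 𝓞 ℚ) ∈ v.asIdeal) (hmult : W.HasMultiplicativeReductionAt v) (hneg : W.Δ < 0)
    (K : Type) [Field K] [NumberField K] (hIQ : IsImaginaryQuadratic K) (hodd : Odd (NumberField.discr K))
    (h3 : NumberField.discr K ≠ -3) (hHe : SatisfiesHeegnerHypothesis (W.conductorNorm ℤ) K)
    (hsq1 : ¬ IsSquare ((NumberField.discr K : ℚ) * -|W.Δ|)) (hsq2 : ¬ IsSquare ((NumberField.discr K : ℚ) * (-(2 * |W.Δ|))))
    (hρ : ∀ n : ℕ, 0 < n → W.HasSurjectiveModNGaloisRep ((2 : ℤ) ^ n))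
    (Dt : ModularParametrizationData W (W.conductorNorm ℤ)) (β : ℤ) (ι : K →+* ℂ) (d₁ : KolyvaginHeegnerData Dt β ι 1) (M₀ : ℕ)
    (hndiv : ¬ ∃ Q : (W.baseChange (ringClassField K ι 1)).toAffine.Point, ((2 ^ (M₀ + 1) : ℕ) : ℤ) • Q = d₁.derivedPoint)
    (B₂ : AddCommGroup.primaryComponent (W.baseChange K).sha 2 →+ AddCommGroup.primaryComponent (W.baseChange K).sha 2 →+ AddCircle (1 : ℚ))
    (halt : ∀ x, B₂ x x = 0) (hnd : ∀ x, (∀ y, B₂ x y = 0) → x = 0)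
    (hiso : ∀ D : AddSubgroup (AddCommGroup.primaryComponent (W.baseChange K).sha 2), (∀ a ∈ D, ∀ b ∈ D, B₂ a b = 0) → Nat.card D ≤ 2 ^ M₀) :
    Nat.card (AddCommGroup.primaryComponent (W.baseChange K).sha 2) ∣ 2 ^ (2 * M₀) := by
  haveI := finite_primaryComponent_sha_two_onHabitat hQ2 W hcm hT v h2v hNv hmult hneg K hIQ hodd h3 hHe hsq1 hsq2 hρ Dt β ι d₁ M₀ hndiv
  obtain ⟨t, ht⟩ := exists_natCard_primaryComponent_sha_two_eq_pow_two_mul_onHabitat hQ2 W hcm hT v h2v hNv hmult hneg K hIQ hodd h3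
    hHe hsq1 hsq2 hρ Dt β ι d₁ M₀ hndiv
  exact natCard_dvd_two_pow_two_mul_of_forall_isotropic_le B₂ ht halt hnd hiso

end Summit.BirchSwinnertonDyer.BirchSwinnertonDyer.Theorems.GenusExact.PlusDescent

end
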